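import Literature.MathematicalPhysics.QuantumFieldTheory.BalabanImbrieJaffe1984to88.BIJ88ConnectedGraphFillingVsupp

/-!
# `BalabanImbrieJaffe1984to88.BIJ88Ineq5144Located` — T. Bałaban, J. Imbrie, A. Jaffe, *Effective action and cluster properties of the abelian
Higgs model*, Commun. Math. Phys. **114** (1988) 257–315 [BalabanImbrieJaffe1988], Sect. 5.14, (5.14.4) p. 309 [PDF 53]: **THE LOCATED READING
OF THE LEAF (5.14.4)** (*"Here H_β ⊂ H specifies which (d/dt)_{γ_j} have supports intersecting X_β"*) — **A KERNEL WITNESS THAT THE UNLOCATED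
INSTANTIATION OF RECORD IS UNSATISFIABLE, AND THE LOCATED TWINS OF THE LEAF LEMMAS OF THE p. 310 "STANDARD EXERCISE", VERBATIM CONCLUSIONS**
(GAPS G-C2-p36-07: a typed-reading defect of ours; nothing of the paper fails).

statement-level skeleton of published theorems with citation tags; proofs where landed; nothing here is a claim about the Yang–Mills mass gap

PDF held: `paper:balaban1988-cmp114-bij-abelian-higgs-effective-action` (journal page = PDF page + 256); pp. 309–310 = PDF 53–54 read this session.
p. 309, verbatim: *"… = Σ_{{X_α} filling Λ₁₂^{(k)}} Π_β g₃(H_β, X_β). (5.14.3) Here H_β ⊂ H specifies which (d/dt)_{γ_j} have supports intersecting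
X_β. … Let us drop the prime, and prove that |g₃(H_β, X_β)| ≤ (e^β(L^kε/ε₀)^{1/4−α})^{[|H_β| + β′|X_β∖H_β|]}. (5.14.4) … Each X_γ must cover and
connect all the t-derivatives specified by H_γ"*.

**§1 THE DEFECT.** Since p25 gen 12 (`BIJ88Expansion5143KP` §Leaf) r16's typed leaf `BIJ88Sect5StatementsPart2.Ineq5144` (abstract `Lab`, `nH`,
`nRest` — NOT at fault) is INSTANTIATED as `Ineq5144 (cubeSys ι) (Finset S) (prime (g3 adj zr)) Finset.card (fun H X => (X ∖ H.image loc).card) θ β′`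
— for ALL pairs `(H, X)`, also label sets NOT located in `X` — and this is the hypothesis `h5144` of every theorem "modulo the leaf" of this seat's
gens 11–13 up to the C2.Eq5.14.5 head theorem of record `BIJ88Eq5145CornerW6.eq5145_zG_mod_W6v_of_ineq5144`.  For SLOT-LOCAL data
(`BIJ88Expansion5143.IsSlotLocal`; the §5.13 Gaussian data is slot-local, `isSlotLocal_zG`) and `loc j ≠ i`: `g₃′({j}, {i}) = zr ∅ {i} {i}`
(`prime_g3_singleton_of_ne`) = the UNdecorated one-cube expectation (in the model `z_t(□_i) ≈ 1`, `= 1` for a cube with no located slot), while the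
unlocated leaf demands `≤ θ^{1+β′}` there: `abs_le_of_ineq5144_unlocated`, **`not_ineq5144_unlocated`**.  Gen 5's regime forces `θ < 1`, so every model
theorem carrying the unlocated leaf has jointly unsatisfiable hypotheses — VACUOUS as stated (model-level corollary: `BIJ88Eq5145CornerW6Loc`).
**§2** `locAct loc g` — the activity on located pairs, `0` elsewhere; THE LEAF BY NAME `Ineq5144 (cubeSys ι) (Finset S) (locAct loc (prime (g3 adj zr)))
Finset.card (…) θ β′` IS the support-conditioned (5.14.4) (`ineq5144_locAct_iff`; p25 g5's `BIJ88W6PrimeBound.ineqW6'_holds` used this form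
internally), implied by the unlocated one (`ineq5144_locAct_of_unlocated`: each located twin implies its landed original).  **§3** the connected-graph
sums see located pairs only (`Cov` in `BIJ88ConnectedGraphResummation.Traw`, gen 13's `TrawFill`): `…_congr_located`.  **§4** in the virtual-support
bookkeeping `wv (locAct loc g)` and `wv g` give the same `Tord/Tsum/TordFill/TsumFill`.  **§5** THE LOCATED TWINS, conclusions verbatim: gen 11's
`BIJ88ConnectedGraphKP310` §2, gen 13's `BIJ88ConnectedGraphFillingVsupp` §3, p25's zero-freeness `corner_empty_ne_zero` — from the LOCATED leaf
(generic tree-graph / Kotecký–Preiss theorems applied to `locAct loc (prime (g3 adj zr))`, transported by §4).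
HONEST SCOPE: (5.14.4) is NOT proved (typed leaf, now read on located pairs; a genuine, satisfiable smallness hypothesis — e.g. block-diagonal
covariance data has all `|X| ≥ 2` activities `0`); nothing landed is modified.  0 `sorry`, 1 definition (`locAct`), 0 `Prop` facts (D-0026); imports
`BIJ88ConnectedGraphFillingVsupp` (p36 g13).  NOT summit progress; NOT continuum; NOT Clay.  Cell `lit-balaban` Phase 2, seat p36 gen 14 (rows
C2.Eq5.14.3-5.14.4 / C2.Claim@310 / C2.Eq5.14.5 member cells, owner r16, referee ref-5; GAPS G-C2-p36-07).
-/

noncomputable section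

namespace Literature.MathematicalPhysics.QuantumFieldTheory.BalabanImbrieJaffe1984to88.BIJ88Ineq5144Located

open Finset
open Literature.Probability.LatticeModels (IsRConnected)
open BIJ88Clusters5134 (cornerSum)
open BIJ88PolymerRep5134 (g1 g1_singleton)
open BIJ88Expansion5143 (g3 prime prime_of_not IsSlotLocal g3_slotsIn slotsIn)
open BIJ88Expansion5143Ordered (polysOf cvsupp locv wv cubesOf)
open BIJ88ConnectedGraphResummation (Cov wprod Traw Tord Tsum)
open BIJ88ConnectedGraphFilling (TrawFill TordFill TsumFill)
open BIJ88ConnectedGraphFillingVsupp (locv_mem_iff TsumFill_vsupp_eq_cornerSum summable_norm_Tord_vsupp_sub abs_TsumFill_vsupp_le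
  summable_norm_TordFill_vsupp regime_split_half)
open BIJ88ConnectedGraphKP310 (sum_abs_Tord_vsupp_le summable_norm_Tord_vsupp abs_Tsum_vsupp_le regime_split prime_g3_eq_zero_of_not_isRConnected)
open BIJ88Ineq5113Covering (cubeSys)
open BIJ88Sect5StatementsPart2 (Ineq5144)

/-! ## §1 The defect: the unlocated instantiation of (5.14.4) is unsatisfiable for slot-local data -/

section Defect

variable {ι : Type} [DecidableEq ι] {S : Type} [DecidableEq S] {adj : ι → ι → Prop} [DecidableRel adj]
  {loc : S → ι} {zr : Finset S → Finset ι → Finset ι → ℝ} {θ β' : ℝ}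

/-- **a label located ELSEWHERE decorates nothing**: for slot-local data and `loc j ≠ i` the prime-dropped activity of `({j}, {i})` is the
UNdecorated one-cube expectation `zr ∅ {i} {i}` (`slotsIn loc {j} {i} = ∅`, `g₁({i}) = z {i} {i}`). [cite: BalabanImbrieJaffe1988, (5.14.3) p.309] -/
theorem prime_g3_singleton_of_ne (hloc : IsSlotLocal loc zr) {j : S} {i : ι} (hji : loc j ≠ i) :
    prime (g3 adj zr) {j} {i} = zr ∅ {i} {i} := by
  rw [prime_of_not _ (by simp), g3_slotsIn hloc]
  have h0 : slotsIn loc ({j} : Finset S) ({i} : Finset ι) = ∅ := by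
    ext x
    simp only [slotsIn, mem_filter, mem_singleton, notMem_empty, iff_false, not_and]
    rintro rfl
    exact hji
  rw [h0, g3, g1_singleton]

/-- **THE UNLOCATED INSTANTIATION FORCES `|zr ∅ {i} {i}| ≤ θ^{1+β′}`** at every cube `i ≠ loc j`: the pair `({j}, {i})` is NOT located, yet the
unlocated instantiation bounds its activity by `θ^{1 + β′·|{i}∖{loc j}|} = θ^{1+β′}`. [cite: BalabanImbrieJaffe1988, (5.14.4) p.309] -/
theorem abs_le_of_ineq5144_unlocated (hloc : IsSlotLocal loc zr)
    (h : Ineq5144 (cubeSys ι) (Finset S) (prime (g3 adj zr)) Finset.card (fun H (X : Finset ι) => (X \ H.image loc).card) θ β')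
    {j : S} {i : ι} (hji : loc j ≠ i) : |zr ∅ {i} {i}| ≤ θ ^ ((1 : ℝ) + β') := by
  have hX := h {j} ({i} : Finset ι)
  dsimp only at hX
  rw [prime_g3_singleton_of_ne hloc hji] at hX
  have hsd : (({i} : Finset ι) \ ({loc j} : Finset ι)) = {i} := by
    rw [sdiff_singleton_eq_erase]
    exact erase_eq_of_notMem (by simpa using hji)
  simpa [hsd] using hX

/-- **THE UNLOCATED INSTANTIATION OF (5.14.4) IS UNSATISFIABLE** for slot-local data, `0 < θ < 1`, `0 ≤ β′`, as soon as some cube `i ≠ loc j` has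
`|zr ∅ {i} {i}| > θ` (in the §5.13 model a cube with no located slot has `zr ∅ {i} {i} = 1`).  The printed (5.14.4) is not at fault: it concerns
located pairs (§2). [cite: BalabanImbrieJaffe1988, (5.14.4) p.309] -/
theorem not_ineq5144_unlocated (hloc : IsSlotLocal loc zr) (hθ0 : 0 < θ) (hθ1 : θ < 1) (hβ : 0 ≤ β') {j : S} {i : ι} (hji : loc j ≠ i)
    (hzi : θ < |zr ∅ {i} {i}|) :
    ¬ Ineq5144 (cubeSys ι) (Finset S) (prime (g3 adj zr)) Finset.card (fun H (X : Finset ι) => (X \ H.image loc).card) θ β' := by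
  intro h
  have h1 := abs_le_of_ineq5144_unlocated hloc h hji
  have h2 : θ ^ ((1 : ℝ) + β') ≤ θ ^ (1 : ℝ) := Real.rpow_le_rpow_of_exponent_ge hθ0 hθ1.le (by linarith)
  rw [Real.rpow_one] at h2
  linarith

end Defect

/-! ## §2 The located activity and the leaf in the located reading -/

section LocAct

variable {ι : Type*} [DecidableEq ι] {S : Type*} {R : Type*} [Zero R]

/-- **the LOCATED activity** (p. 309: *"Here H_β ⊂ H specifies which (d/dt)_{γ_j} have supports intersecting X_β"*): the activity `g(H, X)` on
the pairs with every label of `H` located in `X`, `0` on the other pairs — which occur neither in (5.14.3) (`H_β = slotsIn loc K X_β`) nor in the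
connected-graph sums of p. 310 (`Cov`, §3). [cite: BalabanImbrieJaffe1988, (5.14.3)–(5.14.4) p.309] -/
def locAct (loc : S → ι) (g : Finset S → Finset ι → R) (H : Finset S) (X : Finset ι) : R :=
  if ∀ j ∈ H, loc j ∈ X then g H X else 0

variable {loc : S → ι} {g : Finset S → Finset ι → R} {H : Finset S} {X : Finset ι}

/-- on a located pair the located activity is the activity. [cite: BalabanImbrieJaffe1988, (5.14.3) p.309] -/
theorem locAct_of_loc (h : ∀ j ∈ H, loc j ∈ X) : locAct loc g H X = g H X := if_pos h
/-- off the located pairs the located activity vanishes. [cite: BalabanImbrieJaffe1988, (5.14.3) p.309] -/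
theorem locAct_of_not_loc (h : ¬ ∀ j ∈ H, loc j ∈ X) : locAct loc g H X = 0 := if_neg h
/-- the slot-free pairs are located. [cite: BalabanImbrieJaffe1988, (5.14.3) p.309] -/
@[simp] theorem locAct_empty (X : Finset ι) : locAct loc g ∅ X = g ∅ X := if_pos fun _ h => absurd h (notMem_empty _)
/-- where the activity vanishes so does the located activity. [cite: BalabanImbrieJaffe1988, (5.14.3) p.309] -/
theorem locAct_eq_zero_of_eq_zero (h : g H X = 0) : locAct loc g H X = 0 := by
  unfold locAct
  split_ifs <;> simp [h]

end LocAct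

section Leaf

variable {ι : Type} [DecidableEq ι] {S : Type} {loc : S → ι} {g : Finset S → Finset ι → ℝ} {θ β' : ℝ}

/-- the located activity is bounded by the activity. [cite: BalabanImbrieJaffe1988, (5.14.4) p.309] -/
theorem abs_locAct_le (H : Finset S) (X : Finset ι) : |locAct loc g H X| ≤ |g H X| := by
  unfold locAct
  split_ifs
  · exact le_rfl
  · rw [abs_zero]; exact abs_nonneg _

/-- **THE LEAF BY NAME ON THE LOCATED ACTIVITY IS THE SUPPORT-CONDITIONED BOUND** (`0 < θ`; any counts `nH`, `nRest`): `Ineq5144 (cubeSys ι)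
(Finset S) (locAct loc g) nH nRest θ β′ ↔ ∀ H X, (∀ j ∈ H, loc j ∈ X) → |g H X| ≤ θ^{nH H + β′·nRest H X}`. [cite: BalabanImbrieJaffe1988, (5.14.4) p.309] -/
theorem ineq5144_locAct_iff (hθ0 : 0 < θ) (nH : Finset S → ℕ) (nRest : Finset S → Finset ι → ℕ) :
    Ineq5144 (cubeSys ι) (Finset S) (locAct loc g) nH nRest θ β' ↔
      ∀ (H : Finset S) (X : Finset ι), (∀ j ∈ H, loc j ∈ X) → |g H X| ≤ θ ^ ((nH H : ℝ) + β' * nRest H X) := by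
  constructor
  · intro h H X hHX
    have hX := h H X
    rwa [locAct_of_loc hHX] at hX
  · intro h H X
    change Finset ι at X
    show |locAct loc g H X| ≤ _
    by_cases hHX : ∀ j ∈ H, loc j ∈ X
    · rw [locAct_of_loc hHX]; exact h H X hHX
    · rw [locAct_of_not_loc hHX, abs_zero]; exact Real.rpow_nonneg hθ0.le _

/-- the unlocated instantiation implies the located one (each twin implies its landed original). [cite: BalabanImbrieJaffe1988, (5.14.4) p.309] -/
theorem ineq5144_locAct_of_unlocated (nH : Finset S → ℕ) (nRest : Finset S → Finset ι → ℕ)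
    (h : Ineq5144 (cubeSys ι) (Finset S) g nH nRest θ β') : Ineq5144 (cubeSys ι) (Finset S) (locAct loc g) nH nRest θ β' :=
  fun H X => (abs_locAct_le H X).trans (h H X)

end Leaf

/-! ## §3 The connected-graph sums see located pairs only: located congruence -/

section Congr

variable {V : Type*} {S : Type*} [DecidableEq V] [Fintype V] [DecidableEq S] [Fintype S] {Q : Finset (Finset V)} {loc : S → V}
  {w₁ w₂ : Finset S → Finset V → ℝ} (hw : ∀ (H : Finset S) (Z : Finset V), (∀ j ∈ H, loc j ∈ Z) → w₁ H Z = w₂ H Z)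
include hw

omit [DecidableEq V] [Fintype V] [DecidableEq S] [Fintype S] in
/-- under the covering condition the activity products agree. [cite: BalabanImbrieJaffe1988, p.309 (Sect. 5.14)] -/
theorem wprod_congr_of_cov {ι : Type*} [Fintype ι] {Hs : ι → Finset S} {Z : ι → Finset V} (hc : Cov loc Hs Z) :
    wprod w₁ Hs Z = wprod w₂ Hs Z :=
  prod_congr rfl fun i _ => hw _ _ (hc i)

/-- **the raw connected sum of display 3 sees located pairs only** (`Cov` in `Traw`). [cite: BalabanImbrieJaffe1988, p.309–310 (Sect. 5.14)] -/
theorem Traw_congr_located (ι : Type*) [Fintype ι] [DecidableEq ι] (K : Finset S) : Traw Q loc w₁ ι K = Traw Q loc w₂ ι K := by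
  unfold Traw
  refine sum_congr rfl fun Hs _ => sum_congr rfl fun Z _ => ?_
  split_ifs with h
  · rw [wprod_congr_of_cov hw h.2.2]
  · rfl

/-- degree-wise. [cite: BalabanImbrieJaffe1988, p.310 (Sect. 5.14)] -/
theorem Tord_congr_located (m : ℕ) (K : Finset S) : Tord Q loc w₁ m K = Tord Q loc w₂ m K := by
  unfold Tord
  rw [Traw_congr_located hw]
/-- **the truncated function of display 3 sees located pairs only.** [cite: BalabanImbrieJaffe1988, p.310 (Sect. 5.14)] -/
theorem Tsum_congr_located (K : Finset S) : Tsum Q loc w₁ K = Tsum Q loc w₂ K := by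
  unfold Tsum
  exact tsum_congr fun m => Tord_congr_located hw m K

variable {κ : Type*} [DecidableEq κ] {U : Finset V → Finset κ}

/-- the `X`-pieces of the raw connected sum see located pairs only. [cite: BalabanImbrieJaffe1988, p.310 (Sect. 5.14)] -/
theorem TrawFill_congr_located (X : Finset κ) (ι : Type*) [Fintype ι] [DecidableEq ι] (K : Finset S) :
    TrawFill Q loc w₁ U X ι K = TrawFill Q loc w₂ U X ι K := by
  unfold TrawFill
  refine sum_congr rfl fun Hs _ => sum_congr rfl fun Z _ => ?_
  split_ifs with h
  · rw [wprod_congr_of_cov hw h.2.2.1]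
  · rfl

/-- degree-wise. [cite: BalabanImbrieJaffe1988, p.310 (Sect. 5.14)] -/
theorem TordFill_congr_located (X : Finset κ) (m : ℕ) (K : Finset S) : TordFill Q loc w₁ U X m K = TordFill Q loc w₂ U X m K := by
  unfold TordFill
  rw [TrawFill_congr_located hw]
/-- the `X`-piece of the truncated function sees located pairs only. [cite: BalabanImbrieJaffe1988, p.310 (Sect. 5.14)] -/
theorem TsumFill_congr_located (X : Finset κ) (K : Finset S) : TsumFill Q loc w₁ U X K = TsumFill Q loc w₂ U X K := by
  unfold TsumFill
  exact tsum_congr fun m => TordFill_congr_located hw X m K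

end Congr

/-! ## §4 In the virtual-support bookkeeping: `wv (locAct loc g)` and `wv g` give the same sums -/

section VSupp

variable {ι : Type*} [DecidableEq ι] [Fintype ι] {S : Type*} [DecidableEq S] [Fintype S] {adj : ι → ι → Prop} [DecidableRel adj]
  {loc : S → ι} {g : Finset S → Finset ι → ℝ} {Q : Finset (Finset (ι ⊕ (Finset ι × Finset ι)))}

omit [DecidableEq S] [Fintype S] in
/-- `wv (locAct loc g)` and `wv g` agree on located pairs (`locv loc j ∈ Z̃ ↔ loc j ∈ cubes Z̃`). [cite: BalabanImbrieJaffe1988, p.310 (Sect. 5.14)] -/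
theorem wv_locAct_eq (H : Finset S) (Zv : Finset (ι ⊕ (Finset ι × Finset ι))) (h : ∀ j ∈ H, locv loc j ∈ Zv) :
    wv (locAct loc g) H Zv = wv g H Zv := by
  unfold wv
  exact locAct_of_loc fun j hj => (locv_mem_iff j Zv).1 (h j hj)

/-- **`Tord` of the located activity = `Tord` of the activity.** [cite: BalabanImbrieJaffe1988, p.310 (Sect. 5.14)] -/
theorem Tord_locAct (m : ℕ) (K : Finset S) : Tord Q (locv loc) (wv (locAct loc g)) m K = Tord Q (locv loc) (wv g) m K :=
  Tord_congr_located wv_locAct_eq m K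
/-- **`Tsum` of the located activity = `Tsum` of the activity.** [cite: BalabanImbrieJaffe1988, p.310 (Sect. 5.14)] -/
theorem Tsum_locAct (K : Finset S) : Tsum Q (locv loc) (wv (locAct loc g)) K = Tsum Q (locv loc) (wv g) K :=
  Tsum_congr_located wv_locAct_eq K

/-- `TordFill` of the located activity = `TordFill` of the activity. [cite: BalabanImbrieJaffe1988, p.310 (Sect. 5.14)] -/
theorem TordFill_locAct (X : Finset ι) (m : ℕ) (K : Finset S) :
    TordFill Q (locv loc) (wv (locAct loc g)) cubesOf X m K = TordFill Q (locv loc) (wv g) cubesOf X m K :=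
  TordFill_congr_located wv_locAct_eq X m K
/-- `TsumFill` of the located activity = `TsumFill` of the activity. [cite: BalabanImbrieJaffe1988, p.310 (Sect. 5.14)] -/
theorem TsumFill_locAct (X : Finset ι) (K : Finset S) :
    TsumFill Q (locv loc) (wv (locAct loc g)) cubesOf X K = TsumFill Q (locv loc) (wv g) cubesOf X K :=
  TsumFill_congr_located wv_locAct_eq X K

end VSupp

/-! ## §5 The leaf lemmas of the standard exercise from the LOCATED leaf, verbatim conclusions -/

section Twins

variable {ι : Type} [DecidableEq ι] [Fintype ι] {S : Type} [DecidableEq S] [Fintype S] {adj : ι → ι → Prop} [DecidableRel adj]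
  {nbr : ι → Finset ι} {Δ : ℕ} {W : Finset ι} {loc : S → ι} {zr : Finset S → Finset ι → Finset ι → ℝ} {θ β' : ℝ}

omit [Fintype ι] [DecidableEq S] [Fintype S] [DecidableRel adj] in
/-- `θ^{|H| + β′|X∖loc H|} ≤ (θ^{1−β′})^{|H|}·(θ^{β′})^{|X|}` for `0 < θ ≤ 1`, `0 ≤ β′`. [cite: BalabanImbrieJaffe1988, (5.14.4) p.309] -/
theorem rpow_leaf_le [DecidableEq S] (hθ0 : 0 < θ) (hθ1 : θ ≤ 1) (hβ : 0 ≤ β') (H : Finset S) (X : Finset ι) :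
    θ ^ ((H.card : ℝ) + β' * ((X \ H.image loc).card : ℝ)) ≤ (θ ^ (1 - β')) ^ H.card * (θ ^ β') ^ X.card := by
  have hsd : (X.card : ℝ) - H.card ≤ ((X \ H.image loc).card : ℝ) := by
    have h1 := card_sdiff_add_card_inter X (H.image loc)
    have h2 : (X ∩ H.image loc).card ≤ H.card := (card_le_card inter_subset_right).trans card_image_le
    have h3 : X.card ≤ (X \ H.image loc).card + H.card := by omega
    have h4 : (X.card : ℝ) ≤ ((X \ H.image loc).card : ℝ) + H.card := by exact_mod_cast h3
    linarith
  calc θ ^ ((H.card : ℝ) + β' * ((X \ H.image loc).card : ℝ))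
      ≤ θ ^ ((1 - β') * H.card + β' * X.card) := Real.rpow_le_rpow_of_exponent_ge hθ0 hθ1 (by nlinarith)
    _ = (θ ^ (1 - β')) ^ H.card * (θ ^ β') ^ X.card := by
        rw [Real.rpow_add hθ0, Real.rpow_mul hθ0.le, Real.rpow_mul hθ0.le, Real.rpow_natCast, Real.rpow_natCast]

omit [Fintype ι] [Fintype S] [DecidableRel adj] in
/-- **located leaf ⟹ `|locAct(g₃′)(H, X)| ≤ (θ^{1−β′})^{|H|}·(θ^{β′})^{|X|}` for ALL pairs** (others: `0`) — the `hg` of gen 11's generic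
tree-graph theorems. [cite: BalabanImbrieJaffe1988, (5.14.4) p.309] -/
theorem abs_locAct_prime_g3_le [DecidableRel adj] (hθ0 : 0 < θ) (hθ1 : θ ≤ 1) (hβ : 0 ≤ β')
    (h : Ineq5144 (cubeSys ι) (Finset S) (locAct loc (prime (g3 adj zr))) Finset.card (fun H (X : Finset ι) => (X \ H.image loc).card) θ β')
    (H : Finset S) (X : Finset ι) :
    |locAct loc (prime (g3 adj zr)) H X| ≤ (θ ^ (1 - β')) ^ H.card * (θ ^ β') ^ X.card := by
  have hX := h H X
  dsimp only at hX
  exact hX.trans (rpow_leaf_le hθ0 hθ1 hβ H X)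

omit [Fintype ι] [Fintype S] [DecidableRel adj] in
/-- the same with the decay split off: `≤ (θ^{1−β′})^{|H|}·((θ^{β′/2})^{|X|}·(θ^{β′/2})^{|X|})`. [cite: BalabanImbrieJaffe1988, (5.14.4) p.309] -/
theorem abs_locAct_prime_g3_le_half [DecidableRel adj] (hθ0 : 0 < θ) (hθ1 : θ ≤ 1) (hβ : 0 ≤ β')
    (h : Ineq5144 (cubeSys ι) (Finset S) (locAct loc (prime (g3 adj zr))) Finset.card (fun H (X : Finset ι) => (X \ H.image loc).card) θ β')
    (H : Finset S) (X : Finset ι) :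
    |locAct loc (prime (g3 adj zr)) H X| ≤ (θ ^ (1 - β')) ^ H.card * ((θ ^ (β' / 2)) ^ X.card * (θ ^ (β' / 2)) ^ X.card) := by
  refine (abs_locAct_prime_g3_le hθ0 hθ1 hβ h H X).trans (le_of_eq ?_)
  rw [← mul_pow, ← Real.rpow_add hθ0]
  norm_num

omit [Fintype ι] [Fintype S] in
/-- the located activities vanish off the `adj`-connected polymers (as the activities do). [cite: BalabanImbrieJaffe1988, p.309 (Sect. 5.14)] -/
theorem locAct_prime_g3_eq_zero_of_not_isRConnected (hR : ∀ x y, adj x y → adj y x) {X : Finset ι} (hX : X ∈ polysOf W)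
    (hc : ¬ IsRConnected adj X) (H : Finset S) : locAct loc (prime (g3 adj zr)) H X = 0 :=
  locAct_eq_zero_of_eq_zero (prime_g3_eq_zero_of_not_isRConnected hR hX hc H)

/-- **THE STANDARD EXERCISE FROM THE LOCATED LEAF** — gen 11's `sum_abs_Tord_vsupp_le_of_ineq5144`, conclusion verbatim:
`Σ_{m<N} |Tord_m(b)| ≤ θ^{(1−β′)|b|}·|b|!·(4e²θ^{β′}(Δ+1))·|W|`. [cite: BalabanImbrieJaffe1988, (5.14.4) p.309, p.310 (Sect. 5.14)] -/
theorem sum_abs_Tord_vsupp_le_of_ineq5144_loc (hR : ∀ x y, adj x y → adj y x) (hΔ : ∀ x, (nbr x).card ≤ Δ)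
    (hnbr : ∀ x y, adj x y → y ∈ nbr x) (hθ0 : 0 < θ) (hθ1 : θ ≤ 1) (hβ : 0 ≤ β')
    (hsmall : 16 * ((Δ : ℝ) + 1) ^ 2 * (θ ^ (β' / 2) * Real.exp 2) ≤ 1)
    (h : Ineq5144 (cubeSys ι) (Finset S) (locAct loc (prime (g3 adj zr))) Finset.card (fun H (X : Finset ι) => (X \ H.image loc).card) θ β')
    {b : Finset S} (hb : b.Nonempty) (N : ℕ) :
    ∑ m ∈ range N, |Tord ((polysOf W).image (cvsupp adj W)) (locv loc) (wv (prime (g3 adj zr))) m b| ≤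
      (θ ^ (1 - β')) ^ b.card * b.card.factorial * (2 * (2 * Real.exp 2 * θ ^ β' * ((Δ : ℝ) + 1)) * W.card) := by
  have hs := regime_split (Δ := Δ) hθ0 hθ1 hβ hsmall
  have hmain := sum_abs_Tord_vsupp_le (W := W) (loc := loc) (g := locAct loc (prime (g3 adj zr))) hR hΔ hnbr (Real.rpow_nonneg hθ0.le _)
    (Real.rpow_nonneg hθ0.le _) hs.1 hs.2 (fun _ hX hc H => locAct_prime_g3_eq_zero_of_not_isRConnected hR hX hc H)
    (fun H X _ => abs_locAct_prime_g3_le hθ0 hθ1 hβ h H X) hb N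
  simpa only [Tord_locAct] using hmain

/-- **`hT` FROM THE LOCATED LEAF** — gen 11's `summable_norm_Tord_vsupp_of_ineq5144`, conclusion verbatim.
[cite: BalabanImbrieJaffe1988, (5.14.4) p.309, p.310 (Sect. 5.14)] -/
theorem summable_norm_Tord_vsupp_of_ineq5144_loc (hR : ∀ x y, adj x y → adj y x) (hΔ : ∀ x, (nbr x).card ≤ Δ)
    (hnbr : ∀ x y, adj x y → y ∈ nbr x) (hθ0 : 0 < θ) (hθ1 : θ ≤ 1) (hβ : 0 ≤ β')
    (hsmall : 16 * ((Δ : ℝ) + 1) ^ 2 * (θ ^ (β' / 2) * Real.exp 2) ≤ 1)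
    (h : Ineq5144 (cubeSys ι) (Finset S) (locAct loc (prime (g3 adj zr))) Finset.card (fun H (X : Finset ι) => (X \ H.image loc).card) θ β')
    {b : Finset S} (hb : b.Nonempty) :
    Summable fun m => ‖Tord ((polysOf W).image (cvsupp adj W)) (locv loc) (wv (prime (g3 adj zr))) m b‖ := by
  have hs := regime_split (Δ := Δ) hθ0 hθ1 hβ hsmall
  have hmain := summable_norm_Tord_vsupp (W := W) (loc := loc) (g := locAct loc (prime (g3 adj zr))) hR hΔ hnbr (Real.rpow_nonneg hθ0.le _)
    (Real.rpow_nonneg hθ0.le _) hs.1 hs.2 (fun _ hX hc H => locAct_prime_g3_eq_zero_of_not_isRConnected hR hX hc H)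
    (fun H X _ => abs_locAct_prime_g3_le hθ0 hθ1 hβ h H X) hb
  simpa only [Tord_locAct] using hmain

/-- **the truncated functions of display 3 are bounded, from the located leaf** — gen 11's `abs_Tsum_vsupp_le_of_ineq5144`, conclusion verbatim.
[cite: BalabanImbrieJaffe1988, (5.14.4) p.309, p.310 (Sect. 5.14)] -/
theorem abs_Tsum_vsupp_le_of_ineq5144_loc (hR : ∀ x y, adj x y → adj y x) (hΔ : ∀ x, (nbr x).card ≤ Δ)
    (hnbr : ∀ x y, adj x y → y ∈ nbr x) (hθ0 : 0 < θ) (hθ1 : θ ≤ 1) (hβ : 0 ≤ β')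
    (hsmall : 16 * ((Δ : ℝ) + 1) ^ 2 * (θ ^ (β' / 2) * Real.exp 2) ≤ 1)
    (h : Ineq5144 (cubeSys ι) (Finset S) (locAct loc (prime (g3 adj zr))) Finset.card (fun H (X : Finset ι) => (X \ H.image loc).card) θ β')
    {b : Finset S} (hb : b.Nonempty) :
    |Tsum ((polysOf W).image (cvsupp adj W)) (locv loc) (wv (prime (g3 adj zr))) b| ≤
      (θ ^ (1 - β')) ^ b.card * b.card.factorial * (2 * (2 * Real.exp 2 * θ ^ β' * ((Δ : ℝ) + 1)) * W.card) := by
  have hs := regime_split (Δ := Δ) hθ0 hθ1 hβ hsmall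
  have hmain := abs_Tsum_vsupp_le (W := W) (loc := loc) (g := locAct loc (prime (g3 adj zr))) hR hΔ hnbr (Real.rpow_nonneg hθ0.le _)
    (Real.rpow_nonneg hθ0.le _) hs.1 hs.2 (fun _ hX hc H => locAct_prime_g3_eq_zero_of_not_isRConnected hR hX hc H)
    (fun H X _ => abs_locAct_prime_g3_le hθ0 hθ1 hβ h H X) hb
  simpa only [Tsum_locAct] using hmain

/-- **`hT` of every sub-region gas from the located leaf** — gen 13's `summable_norm_Tord_vsupp_sub_of_ineq5144`, verbatim conclusion.
[cite: BalabanImbrieJaffe1988, (5.14.4) p.309, p.310 (Sect. 5.14)] -/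
theorem summable_norm_Tord_vsupp_sub_of_ineq5144_loc (hR : ∀ x y, adj x y → adj y x) (hΔ : ∀ x, (nbr x).card ≤ Δ)
    (hnbr : ∀ x y, adj x y → y ∈ nbr x) (hθ0 : 0 < θ) (hθ1 : θ ≤ 1) (hβ : 0 ≤ β')
    (hsmall : 16 * ((Δ : ℝ) + 1) ^ 2 * (θ ^ (β' / 2) * Real.exp 2) ≤ 1)
    (h : Ineq5144 (cubeSys ι) (Finset S) (locAct loc (prime (g3 adj zr))) Finset.card (fun H (X : Finset ι) => (X \ H.image loc).card) θ β')
    {X : Finset ι} (hXW : X ⊆ W) {b : Finset S} (hb : b.Nonempty) :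
    Summable fun m => ‖Tord ((polysOf X).image (cvsupp adj X)) (locv loc) (wv (prime (g3 adj zr))) m b‖ := by
  have hs := regime_split_half (Δ := Δ) (β' := β') hθ0 hsmall
  have hmain := summable_norm_Tord_vsupp_sub (W := W) (loc := loc) (g := locAct loc (prime (g3 adj zr))) hR hΔ hnbr
    (Real.rpow_nonneg hθ0.le _) (Real.rpow_nonneg hθ0.le _) (Real.rpow_nonneg hθ0.le _) (Real.rpow_le_one hθ0.le hθ1 (by linarith)) hs.1 hs.2
    (fun _ hX hc H => locAct_prime_g3_eq_zero_of_not_isRConnected hR hX hc H) (fun H X _ => abs_locAct_prime_g3_le_half hθ0 hθ1 hβ h H X) hXW hb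
  simpa only [Tord_locAct] using hmain

/-- **the `X`-piece as a corner sum of sub-region truncated functions, from the located leaf** (gen 13's `TsumFill_vsupp_eq_cornerSum_of_ineq5144`
verbatim). [cite: BalabanImbrieJaffe1988, p.310 (Sect. 5.14); (5.14.4) p.309] -/
theorem TsumFill_vsupp_eq_cornerSum_of_ineq5144_loc (hR : ∀ x y, adj x y → adj y x) (hΔ : ∀ x, (nbr x).card ≤ Δ)
    (hnbr : ∀ x y, adj x y → y ∈ nbr x) (hθ0 : 0 < θ) (hθ1 : θ ≤ 1) (hβ : 0 ≤ β')
    (hsmall : 16 * ((Δ : ℝ) + 1) ^ 2 * (θ ^ (β' / 2) * Real.exp 2) ≤ 1)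
    (h : Ineq5144 (cubeSys ι) (Finset S) (locAct loc (prime (g3 adj zr))) Finset.card (fun H (X : Finset ι) => (X \ H.image loc).card) θ β')
    {X : Finset ι} (hXW : X ⊆ W) {K : Finset S} (hK : K.Nonempty) :
    TsumFill ((polysOf W).image (cvsupp adj W)) (locv loc) (wv (prime (g3 adj zr))) cubesOf X K =
      cornerSum (fun X' => Tsum ((polysOf X').image (cvsupp adj X')) (locv loc) (wv (prime (g3 adj zr))) K) X :=
  TsumFill_vsupp_eq_cornerSum hXW fun _ hX' =>
    (summable_norm_Tord_vsupp_sub_of_ineq5144_loc (W := W) hR hΔ hnbr hθ0 hθ1 hβ hsmall h (hX'.trans hXW) hK).of_norm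

/-- **the `|X|`-decay of the `X`-piece, from the located leaf** (gen 13's `abs_TsumFill_vsupp_le_of_ineq5144` verbatim). [cite: BalabanImbrieJaffe1988, p.310; (5.14.4) p.309] -/
theorem abs_TsumFill_vsupp_le_of_ineq5144_loc (hR : ∀ x y, adj x y → adj y x) (hΔ : ∀ x, (nbr x).card ≤ Δ)
    (hnbr : ∀ x y, adj x y → y ∈ nbr x) (hθ0 : 0 < θ) (hθ1 : θ ≤ 1) (hβ : 0 ≤ β')
    (hsmall : 16 * ((Δ : ℝ) + 1) ^ 2 * (θ ^ (β' / 2) * Real.exp 2) ≤ 1)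
    (h : Ineq5144 (cubeSys ι) (Finset S) (locAct loc (prime (g3 adj zr))) Finset.card (fun H (X : Finset ι) => (X \ H.image loc).card) θ β')
    {X : Finset ι} (hXW : X ⊆ W) {b : Finset S} (hb : b.Nonempty) :
    |TsumFill ((polysOf W).image (cvsupp adj W)) (locv loc) (wv (prime (g3 adj zr))) cubesOf X b| ≤
      (θ ^ (β' / 2)) ^ X.card * ((θ ^ (1 - β')) ^ b.card * b.card.factorial *
        (2 * (2 * Real.exp 2 * θ ^ (β' / 2) * ((Δ : ℝ) + 1)) * X.card)) := by
  have hs := regime_split_half (Δ := Δ) (β' := β') hθ0 hsmall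
  have hmain := abs_TsumFill_vsupp_le (W := W) (loc := loc) (g := locAct loc (prime (g3 adj zr))) hR hΔ hnbr (Real.rpow_nonneg hθ0.le _)
    (Real.rpow_nonneg hθ0.le _) (Real.rpow_nonneg hθ0.le _) (Real.rpow_le_one hθ0.le hθ1 (by linarith)) hs.1 hs.2
    (fun _ hX hc H => locAct_prime_g3_eq_zero_of_not_isRConnected hR hX hc H) (fun H X _ => abs_locAct_prime_g3_le_half hθ0 hθ1 hβ h H X) hXW hb
  simpa only [TsumFill_locAct] using hmain

/-- … and the series of the `X`-piece converges absolutely, from the located leaf. [cite: BalabanImbrieJaffe1988, p.310 (Sect. 5.14); (5.14.4) p.309] -/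
theorem summable_norm_TordFill_vsupp_of_ineq5144_loc (hR : ∀ x y, adj x y → adj y x) (hΔ : ∀ x, (nbr x).card ≤ Δ)
    (hnbr : ∀ x y, adj x y → y ∈ nbr x) (hθ0 : 0 < θ) (hθ1 : θ ≤ 1) (hβ : 0 ≤ β')
    (hsmall : 16 * ((Δ : ℝ) + 1) ^ 2 * (θ ^ (β' / 2) * Real.exp 2) ≤ 1)
    (h : Ineq5144 (cubeSys ι) (Finset S) (locAct loc (prime (g3 adj zr))) Finset.card (fun H (X : Finset ι) => (X \ H.image loc).card) θ β')
    {X : Finset ι} (hXW : X ⊆ W) {b : Finset S} (hb : b.Nonempty) :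
    Summable fun m => ‖TordFill ((polysOf W).image (cvsupp adj W)) (locv loc) (wv (prime (g3 adj zr))) cubesOf X m b‖ := by
  have hs := regime_split_half (Δ := Δ) (β' := β') hθ0 hsmall
  have hmain := summable_norm_TordFill_vsupp (W := W) (loc := loc) (g := locAct loc (prime (g3 adj zr))) hR hΔ hnbr
    (Real.rpow_nonneg hθ0.le _) (Real.rpow_nonneg hθ0.le _) (Real.rpow_nonneg hθ0.le _) (Real.rpow_le_one hθ0.le hθ1 (by linarith)) hs.1 hs.2
    (fun _ hX hc H => locAct_prime_g3_eq_zero_of_not_isRConnected hR hX hc H) (fun H X _ => abs_locAct_prime_g3_le_half hθ0 hθ1 hβ h H X) hXW hb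
  simpa only [TordFill_locAct] using hmain

end Twins

end Literature.MathematicalPhysics.QuantumFieldTheory.BalabanImbrieJaffe1984to88.BIJ88Ineq5144Located

end
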